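import Literature.MathematicalPhysics.QuantumFieldTheory.Balaban1983to89.B5Eq114Gauss

/-!
# `Balaban1983to89.B5Eq119ZProduct` — T. Bałaban, *Propagators and renormalization transformations for lattice gauge
theories. I*, Commun. Math. Phys. **95** (1984) 17–40 [Balaban1984PropagatorsI], Sect. B p. 20: **«Z_{k,Ax} =
Z^{(k−1)}·…·Z^{(0)}, where Z^{(j)} is a normalization factor connected with j + 1 integration»** — the normalisation of
(1.19) IS A k-FOLD PRODUCT of one-step Gaussian normalisations, because `(ST)` maps a centred Gaussian density to a
centred Gaussian density («We can apply the renormalization transformation again to (1.14)»): `(ST)^k` ITERATED ON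
GAUSSIANS along the B5 owner's tower `B5SectBStatements.towerM/iterST`, with the covariance recursion it generates

statement-level skeleton of published theorems with citation tags; proofs where landed; nothing here is a claim about the Yang–Mills mass gap

PDF held: `paper:balaban1984-cmp95-propagators-rt-i` (journal page = PDF page + 16); pages READ AS IMAGES by this seat:
render `run/shared/lean/pub/pub-balaban/b2b-balaban-ref1/pages/1984-cmp95-propagators-rt-I/…-p004-x2.png` (p. 20:
Sect. B, (1.16)–(1.19)); p. 19 (1.12)/(1.14) through `B5Eq114Gauss`.

CITATION HEADER (lean-in-tree rule).  Cell `lit-balaban` (HOME `run/shared/lean/pub/lit-balaban/`), unit `lit-balaban-p21`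
gen 4 (`literature-prover-lit-balaban-p21-g4-0`); WHAT IS REPRODUCED = SKELETON row **B5.Eq1.19**, its last un-typed
sentence (r02's `B5Eq114Gauss` HONEST SCOPE (iii): «the product sentence … not as a k-fold product»), with the sentence
opening Sect. B (row B5.Eq1.16-1.19).  Owner r02, referee ref-4.  Kind «discharge of a printed identity for typed
objects»; bookkeeping `def`s with bodies (`stepW`/`stepZ`/`Witer`/`Zprod`/`Zfactors`), NO `Prop` fact.

WHAT IS PRINTED (verbatim, p. 20 [PDF 4]).  «B. Compositions of Renormalization Transformations. Basic Sequence of Actions.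
We can apply the renormalization transformation again to (1.14). A composition of two transformations is easy to
calculate: … (1.16) … It is easily seen that a composition of k transformations is given by ((ST)^k e^{−S})(B) =
z^{(k)}∫dA δ(B − Q_kA)δ_Ax(Q_{k−1}A)·…·δ_Ax(A)e^{−S^η(A)}, (1.17) … We define ((ST)^k e^{−S})(B) = Z_{k,Ax} exp(−½⟨B,
Δ_kB⟩). (1.19) It is easily seen that Z_{k,Ax} = Z^{(k−1)}·…·Z^{(0)}, where Z^{(j)} is a normalization factor
connected with j + 1 integration.»  And p. 19 (1.14): «A result of the integration is obviously a Gaussian density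
(Te^{−S})(B) = Z^{(0)} exp(−½⟨B, Δ₁B⟩)».

TYPED OBJECTS (all r02's, `B5SectBStatements`/`B5Eq114Gauss`): tower `towerM L M k` (`towerM (k+1) = fine L (towerM k)`
definitionally), `(ST)^k = iterST` (`iterST_succ`: the FIRST integration is the finest), `T = rtT` (1.12), `S = scaleDens`
(σ = `sigmaL d L`), `γ₁ = B5GaussSectC.gaussW _ 1`, `ZT`/`Rim`/`integral_gaussW_sub_T`, `Z0`/`Wmap`/`Delta1`, `Zk`/`Wk`/`DeltaK`.

WHAT THIS FILE PROVES (kernel-checked, 0 sorry, axioms ⊆ {propext, Classical.choice, Quot.sound}; every `d`, `L ≥ 1`,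
torus `M`, `k`, unless `2 ≤ d` is displayed; U = 1).
§1 **ONE STEP ON A GAUSSIAN** (torus `N`, blocks of side `n`): for every finite-dimensional real inner product space `P`
   and linear `W : Fld (fine n N) → P`, `T(γ₁∘W)(B) = Z⁽W⁾·γ₁(W′B)` (`rtT_gaussW`), `stepZ W = ∫_{N(Q)∩Ax} γ₁(Wv)dv`,
   `stepW W = (1 − R_W)∘W∘sec` (`R_W` = orthogonal projection onto `W(N(Q)∩Ax)`); at `W = 𝒯` (`e^{−S} = γ₁∘𝒯`) these ARE
   r02's `Z0`/`Wmap` of (1.14) (`stepZ_curvLin`, `stepW_curvLin`, `rfl`); `scaleDens_rtT_gaussW` adds the rescaling.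
§2 **ITERATION**: `Witer k W`, `Zprod k W`, `Zfactors k W` by recursion along `iterST_succ` (finest step first), and
   **`iterST_gaussW : (ST)^k(γ₁∘W)(B) = Zprod k W · γ₁(Witer k W B)`** for EVERY `k`, `W`, `B` — `(ST)^k` maps centred
   Gaussians to centred Gaussians — with `Zprod k W = (Zfactors k W).prod`, `(Zfactors k W).length = k`: the
   normalisation is an honest k-fold product of one-step normalisations (`Zprod_eq_prod`, `length_Zfactors`);
   linearity `iterST_const_mul`.
§3 **THE BASIC SEQUENCE OF ACTIONS, STEP BY STEP**: `iterST_succ_gauss : (ST)^{k+1}e^{−S}(B) = Z^{(0)}_{(k)}·(ST)^k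
   [exp(−½⟨·, σ²Δ₁^{(k)}·⟩)](B)` — «We can apply the renormalization transformation again to (1.14)» (r02's
   `iterST_one_gauss` at the torus `towerM L M k`; `Z^{(0)}_{(k)} = Z0 L (towerM L M k)`); `iterST_exp_eq_Zprod`.
§4 **«Z_{k,Ax} = Z^{(k−1)}·…·Z^{(0)}» FOR r02's (1.19)** (d ≥ 2): `S1 M (DeltaK L M k) B = ½‖Witer k 𝒯 B‖²`,
   **`DeltaK_eq_adjoint_Witer : DeltaK L M k = (Witer k 𝒯)† ∘ Witer k 𝒯`** (Gaussian uniqueness against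
   `rt17_gauss`/`eq117_holds`, then polarisation), `Zprod_curvLin_pos`, `Zfactors_curvLin_pos`, and **`eq119_prod :
   ∃ Zs : List ℝ, Zs.length = k ∧ (∀ z ∈ Zs, 0 < z) ∧ ∀ B, (ST)^k e^{−S}(B) = Zs.prod · exp(−S1 M (DeltaK L M k) B)`**.

HONEST SCOPE.  (i) `Z^{(j)}` is typed as the Gaussian normalisation of the (j+1)-th one-step integration of the typed
`(ST)^k` (finest level first, as `iterST` is defined): `Zfactors k 𝒯 = [Z^{(k−1)}, …, Z^{(0)}]`, `Z^{(0)} = Z0 L (towerM L M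
(k−1))` (the (1.14) normalisation of the finest step), `Z^{(j)} = stepZ` of the Gaussian produced by the first `j` steps;
`S` contributes no Jacobian at the level of densities (`scaleDens` substitutes `σB`), so the `z^{(k)}` of (1.17) do not
appear (r02's `rt17` bookkeeping: `Zprod k 𝒯 = z^{(k)}·Zk k`, `Zprod_curvLin_eq`).  (ii) §1–§3 hold with NO hypothesis
(cf. `B5Eq114Gauss` HONEST SCOPE (ii)); positivity and the identification with `DeltaK` use `2 ≤ d` (r02's
`eq117_holds`/`Zk_pos`).  (iii) Torus model, U = 1, every `L ≥ 1`.  Value = the last sentence of (1.19) typed and proved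
+ the basic sequence of actions generated by iterating the one-step Gaussian map, in the kernel; NOT summit progress.
-/

open scoped BigOperators InnerProductSpace
open MeasureTheory

namespace Literature.MathematicalPhysics.QuantumFieldTheory.Balaban1983to89.B5Eq119ZProduct

open B5SectBStatements B5Eq114Gauss
open B5Prop11Plancherel (Tor fine)
open B5GaussSectC (gaussW gaussW_neg gaussW_pos)

noncomputable section

variable {d : ℕ}

/-! ## §1  One step on a Gaussian density: `T(γ₁∘W) = Z⁽W⁾·γ₁∘W′` -/

section Step

variable (n : ℕ) [NeZero n] (N : Fin d → ℕ) [hN : ∀ μ, NeZero (N μ)]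
variable {P : Type*} [NormedAddCommGroup P] [InnerProductSpace ℝ P] [FiniteDimensional ℝ P]

/-- **`Z^{(j)}`, the normalisation factor of ONE integration** applied to the Gaussian `γ₁∘W`: `∫_{N(Q)∩Ax} γ₁(Wv) dv`
(r02's `ZT` on the fibre directions of (1.12); at `W = 𝒯` it is `Z^{(0)}` of (1.14), `stepZ_curvLin`).
[cite: Balaban1984PropagatorsI, (1.19) p.20, (1.14) p.19] -/
def stepZ (W : Fld (fine n N) →ₗ[ℝ] P) : ℝ := ZT W (dirSpace (Qlin n N) (Ax n N)) 1

/-- **the one-step map on Gaussians** `W′ = (1 − R_W)∘W∘sec` (`R_W` = orthogonal projection onto `W(N(Q)∩Ax)`, `sec` the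
axial section): `T(γ₁∘W) = Z⁽W⁾·γ₁∘W′` (`rtT_gaussW`). [cite: Balaban1984PropagatorsI, (1.14) p.19, (1.19) p.20] -/
def stepW (W : Fld (fine n N) →ₗ[ℝ] P) : Fld N →ₗ[ℝ] P :=
  (LinearMap.id - (Rim W (dirSpace (Qlin n N) (Ax n N))).toLinearMap) ∘ₗ W ∘ₗ secLin n N

/-- at `𝒯` (`e^{−S} = γ₁∘𝒯`) the one-step map is r02's `Wmap` of (1.14). [cite: Balaban1984PropagatorsI, (1.14) p.19] -/
theorem stepW_curvLin : stepW n N (curvLin (fine n N)) = Wmap n N := rfl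

/-- at `𝒯` the one-step normalisation is r02's `Z^{(0)}` of (1.14). [cite: Balaban1984PropagatorsI, (1.14) p.19] -/
theorem stepZ_curvLin : stepZ n N (curvLin (fine n N)) = Z0 n N := rfl

omit [FiniteDimensional ℝ P] in
/-- `Z⁽W⁾ ≥ 0`. [cite: Balaban1984PropagatorsI, (1.19) p.20] -/
theorem stepZ_nonneg (W : Fld (fine n N) →ₗ[ℝ] P) : 0 ≤ stepZ n N W :=
  integral_nonneg fun _ => (gaussW_pos 1 _).le

/-- **`T` MAPS A CENTRED GAUSSIAN TO A CENTRED GAUSSIAN**: `(T(γ₁∘W))(B) = Z⁽W⁾·γ₁(W′B)` for every `B` — (1.14) for a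
general Gaussian density in place of `e^{−S}` (r02's `integral_gaussW_sub_T`). [cite: Balaban1984PropagatorsI, (1.14) p.19] -/
theorem rtT_gaussW (W : Fld (fine n N) →ₗ[ℝ] P) (B : Fld N) :
    rtT n N (fun A => gaussW P 1 (W A)) B = stepZ n N W * gaussW P 1 (stepW n N W B) := by
  rw [rtT_eq]
  have hfun : (fun v : dirSpace (Qlin n N) (Ax n N) => gaussW P 1 (W (secFld n N B + (v : Fld (fine n N)))))
      = fun v : dirSpace (Qlin n N) (Ax n N) => gaussW P 1 ((-W (secFld n N B)) - W (v : Fld (fine n N))) := by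
    funext v; rw [map_add, ← gaussW_neg]; congr 1; abel
  rw [hfun, integral_gaussW_sub_T W (dirSpace (Qlin n N) (Ax n N)) 1, stepZ, stepW, LinearMap.comp_apply,
    LinearMap.comp_apply, LinearMap.sub_apply, LinearMap.id_apply, ContinuousLinearMap.coe_coe, secLin_apply, map_neg,
    show -W (secFld n N B) - -(Rim W (dirSpace (Qlin n N) (Ax n N))) (W (secFld n N B))
      = -(W (secFld n N B) - (Rim W (dirSpace (Qlin n N) (Ax n N))) (W (secFld n N B))) by abel, gaussW_neg]

/-- linearity of `T` in the density: constants come out. [cite: Balaban1984PropagatorsI, (1.12) p.19] -/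
theorem rtT_const_mul (c : ℝ) (ρ : Fld (fine n N) → ℝ) :
    rtT n N (fun A => c * ρ A) = fun B => c * rtT n N ρ B := by
  funext B
  exact deltaInt_const_mul _ _ c ρ B

end Step

section StepScaled

variable (L : ℕ) [NeZero L] (N : Fin d → ℕ) [hN : ∀ μ, NeZero (N μ)]
variable {P : Type*} [NormedAddCommGroup P] [InnerProductSpace ℝ P] [FiniteDimensional ℝ P]

omit [NeZero L] hN in
/-- linearity of the rescaling `S` in the density. [cite: Balaban1984PropagatorsI, (1.5) p.18] -/
theorem scaleDens_const_mul (c : ℝ) (g : Fld N → ℝ) :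
    scaleDens L (fun B => c * g B) = fun B => c * scaleDens L g B := rfl

/-- **`(ST)` on a Gaussian**: `(ST(γ₁∘W))(B) = Z⁽W⁾·γ₁((σ·W′)B)`, `σ = L^{−(d−2)/2}` (the rescaling substitutes `σB`, no
Jacobian at the level of densities). [cite: Balaban1984PropagatorsI, (1.19) p.20, (1.5) p.18] -/
theorem scaleDens_rtT_gaussW (W : Fld (fine L N) →ₗ[ℝ] P) (B : Fld N) :
    scaleDens L (rtT L N (fun A => gaussW P 1 (W A))) B
      = stepZ L N W * gaussW P 1 ((sigmaL d L • stepW L N W) B) := by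
  rw [scaleDens_apply, rtT_gaussW, map_smul, LinearMap.smul_apply]

end StepScaled

/-! ## §2  Iteration along the tower: `(ST)^k(γ₁∘W) = Zprod·γ₁∘Witer`, `Zprod` a k-fold product -/

section Tower

variable (L : ℕ) [NeZero L] (M : Fin d → ℕ) [hM : ∀ μ, NeZero (M μ)]
variable {P : Type*} [NormedAddCommGroup P] [InnerProductSpace ℝ P] [FiniteDimensional ℝ P]

/-- **the iterated Gaussian map** along the tower (finest step first, as `iterST`): `Witer 0 W = W`,
`Witer (k+1) W = Witer k (σ·W′)`. [cite: Balaban1984PropagatorsI, (1.16)–(1.17) p.20] -/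
def Witer : (k : ℕ) → (Fld (towerM L M k) →ₗ[ℝ] P) → (Fld M →ₗ[ℝ] P)
  | 0, W => W
  | k + 1, W => Witer k (sigmaL d L • stepW L (towerM L M k) W)

/-- **the iterated normalisation, A PRODUCT**: `Zprod 0 W = 1`, `Zprod (k+1) W = Z⁽W⁾ · Zprod k (σ·W′)` — «Z_{k,Ax} =
Z^{(k−1)}·…·Z^{(0)}». [cite: Balaban1984PropagatorsI, (1.19) p.20] -/
def Zprod : (k : ℕ) → (Fld (towerM L M k) →ₗ[ℝ] P) → ℝ
  | 0, _ => 1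
  | k + 1, W => stepZ L (towerM L M k) W * Zprod k (sigmaL d L • stepW L (towerM L M k) W)

/-- **the list of factors `[Z^{(k−1)}, …, Z^{(0)}]`**: `Z^{(j)}` = the normalisation of the (j+1)-th (from the finest)
integration («Z^{(j)} is a normalization factor connected with j + 1 integration»). [cite: Balaban1984PropagatorsI, (1.19) p.20] -/
def Zfactors : (k : ℕ) → (Fld (towerM L M k) →ₗ[ℝ] P) → List ℝ
  | 0, _ => []
  | k + 1, W => Zfactors k (sigmaL d L • stepW L (towerM L M k) W) ++ [stepZ L (towerM L M k) W]

/-- unfolding. [cite: Balaban1984PropagatorsI, (1.17) p.20] -/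
theorem Witer_zero (W : Fld (towerM L M 0) →ₗ[ℝ] P) : Witer L M 0 W = W := rfl

/-- unfolding: one more (finest) step = precompose the one-step map. [cite: Balaban1984PropagatorsI, (1.16)–(1.17) p.20] -/
theorem Witer_succ (k : ℕ) (W : Fld (towerM L M (k + 1)) →ₗ[ℝ] P) :
    Witer L M (k + 1) W = Witer L M k (sigmaL d L • stepW L (towerM L M k) W) := rfl

/-- unfolding. [cite: Balaban1984PropagatorsI, (1.19) p.20] -/
theorem Zprod_zero (W : Fld (towerM L M 0) →ₗ[ℝ] P) : Zprod L M 0 W = 1 := rfl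

/-- unfolding: `Zprod (k+1) W = Z⁽W⁾ · Zprod k (σ·W′)`. [cite: Balaban1984PropagatorsI, (1.19) p.20] -/
theorem Zprod_succ (k : ℕ) (W : Fld (towerM L M (k + 1)) →ₗ[ℝ] P) :
    Zprod L M (k + 1) W = stepZ L (towerM L M k) W * Zprod L M k (sigmaL d L • stepW L (towerM L M k) W) := rfl

/-- **«Z_{k,Ax} = Z^{(k−1)}·…·Z^{(0)}»**: the iterated normalisation is the product of the list of one-step factors.
[cite: Balaban1984PropagatorsI, (1.19) p.20] -/
theorem Zprod_eq_prod : ∀ (k : ℕ) (W : Fld (towerM L M k) →ₗ[ℝ] P), Zprod L M k W = (Zfactors L M k W).prod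
  | 0, _ => rfl
  | k + 1, W => by
      rw [Zprod_succ, Zfactors, List.prod_append, List.prod_singleton, Zprod_eq_prod k, mul_comm]

/-- there are exactly `k` factors. [cite: Balaban1984PropagatorsI, (1.19) p.20] -/
theorem length_Zfactors : ∀ (k : ℕ) (W : Fld (towerM L M k) →ₗ[ℝ] P), (Zfactors L M k W).length = k
  | 0, _ => rfl
  | k + 1, W => by rw [Zfactors, List.length_append, List.length_singleton, length_Zfactors k]

/-- every factor is `≥ 0`. [cite: Balaban1984PropagatorsI, (1.19) p.20] -/
theorem Zfactors_nonneg : ∀ (k : ℕ) (W : Fld (towerM L M k) →ₗ[ℝ] P), ∀ z ∈ Zfactors L M k W, 0 ≤ z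
  | 0, _ => by simp [Zfactors]
  | k + 1, W => by
      intro z hz
      rw [Zfactors, List.mem_append, List.mem_singleton] at hz
      rcases hz with hz | rfl
      · exact Zfactors_nonneg k _ z hz
      · exact stepZ_nonneg L (towerM L M k) W

/-- `Zprod ≥ 0`. [cite: Balaban1984PropagatorsI, (1.19) p.20] -/
theorem Zprod_nonneg (k : ℕ) (W : Fld (towerM L M k) →ₗ[ℝ] P) : 0 ≤ Zprod L M k W := by
  rw [Zprod_eq_prod]
  exact List.prod_nonneg (Zfactors_nonneg L M k W)

/-- linearity of `(ST)^k` in the density. [cite: Balaban1984PropagatorsI, (1.17) p.20] -/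
theorem iterST_const_mul : ∀ (k : ℕ) (c : ℝ) (ρ : Fld (towerM L M k) → ℝ),
    iterST L M k (fun A => c * ρ A) = fun B => c * iterST L M k ρ B
  | 0, _, _ => rfl
  | k + 1, c, ρ => by
      funext B
      have h1 : rtT L (towerM L M k) (fun A : Fld (towerM L M (k + 1)) => c * ρ A)
          = fun B' => c * rtT L (towerM L M k) ρ B' := rtT_const_mul L (towerM L M k) c ρ
      rw [iterST_succ, iterST_succ, h1, scaleDens_const_mul, iterST_const_mul k]

/-- **`(ST)^k` MAPS CENTRED GAUSSIANS TO CENTRED GAUSSIANS, WITH A k-FOLD PRODUCT NORMALISATION**: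
`((ST)^k(γ₁∘W))(B) = Zprod k W · γ₁(Witer k W B)` for every `k`, `W`, `B` (induction along `iterST_succ`: each step is
§1). [cite: Balaban1984PropagatorsI, (1.16)–(1.17) p.20, (1.19) p.20] -/
theorem iterST_gaussW : ∀ (k : ℕ) (W : Fld (towerM L M k) →ₗ[ℝ] P) (B : Fld M),
    iterST L M k (fun A => gaussW P 1 (W A)) B = Zprod L M k W * gaussW P 1 (Witer L M k W B)
  | 0, W, B => by
      rw [iterST_zero, Zprod_zero, Witer_zero, one_mul]
      rfl
  | k + 1, W, B => by
      have hstep : scaleDens L (rtT L (towerM L M k) fun A : Fld (towerM L M (k + 1)) => gaussW P 1 (W A))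
          = fun B' => stepZ L (towerM L M k) W
              * gaussW P 1 ((sigmaL d L • stepW L (towerM L M k) W) B') :=
        funext fun B' => scaleDens_rtT_gaussW L (towerM L M k) W B'
      rw [iterST_succ, hstep, iterST_const_mul]
      dsimp only
      rw [iterST_gaussW k, Zprod_succ, Witer_succ, mul_assoc]

/-- the Gaussian profile of a linear image as a quadratic form: `γ₁(WB) = exp(−½⟨B, W†WB⟩)` (r02's `S1`).
[cite: Balaban1984PropagatorsI, (1.19) p.20] -/
theorem gaussW_eq_exp_neg_S1 (W : Fld M →ₗ[ℝ] P) (B : Fld M) :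
    gaussW P 1 (W B) = Real.exp (-S1 M (LinearMap.adjoint W ∘ₗ W) B) := by
  rw [gaussW, S1, LinearMap.comp_apply, LinearMap.adjoint_inner_right, real_inner_self_eq_norm_sq]
  congr 1
  ring

/-- hence `((ST)^k(γ₁∘W))(B) = Zprod·exp(−½⟨B, (Witer)†(Witer)B⟩)`: the image is the centred Gaussian with covariance
operator `(Witer k W)†(Witer k W)`. [cite: Balaban1984PropagatorsI, (1.19) p.20] -/
theorem iterST_gaussW_S1 (k : ℕ) (W : Fld (towerM L M k) →ₗ[ℝ] P) (B : Fld M) :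
    iterST L M k (fun A => gaussW P 1 (W A)) B
      = Zprod L M k W * Real.exp (-S1 M (LinearMap.adjoint (Witer L M k W) ∘ₗ Witer L M k W) B) := by
  rw [iterST_gaussW, gaussW_eq_exp_neg_S1]

/-! ## §3  The basic sequence of actions, step by step: «apply the renormalization transformation again to (1.14)» -/

/-- `e^{−S} = γ₁∘𝒯` as functions (r02's `exp_neg_action1`). [cite: Balaban1984PropagatorsI, (1.5) p.18] -/
theorem exp_neg_action1_eq (N : Fin d → ℕ) [∀ μ, NeZero (N μ)] :
    (fun A : Fld N => Real.exp (-action1 A)) = fun A => gaussW (B5Eq114Gauss.Plaq N) 1 (curvLin N A) :=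
  funext fun A => exp_neg_action1 N A

/-- **`((ST)^k e^{−S})(B) = Zprod k 𝒯 · γ₁(Witer k 𝒯 B)`**: (1.19) with the normalisation AS A PRODUCT and the
covariance as the iterated one-step map, every `k`, no hypothesis. [cite: Balaban1984PropagatorsI, (1.19) p.20] -/
theorem iterST_exp_eq_Zprod (k : ℕ) (B : Fld M) :
    iterST L M k (fun A => Real.exp (-action1 A)) B
      = Zprod L M k (curvLin (towerM L M k))
        * gaussW (B5Eq114Gauss.Plaq (towerM L M k)) 1 (Witer L M k (curvLin (towerM L M k)) B) := by
  rw [exp_neg_action1_eq, iterST_gaussW]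

/-- **«We can apply the renormalization transformation again to (1.14)»**: the FIRST integration of `(ST)^{k+1}e^{−S}`
is (1.14) on level `k` of the tower — `((ST)^{k+1}e^{−S})(B) = Z^{(0)}_{(k)} · ((ST)^k[exp(−½⟨·, σ²Δ₁^{(k)}·⟩)])(B)`
with `Z^{(0)}_{(k)} = Z0 L (towerM L M k)`, `Δ₁^{(k)} = Delta1 L (towerM L M k)` (r02's (1.14) data at the torus
`towerM L M k`). [cite: Balaban1984PropagatorsI, (1.16) p.20, (1.14) p.19] -/
theorem iterST_succ_gauss (k : ℕ) (B : Fld M) :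
    iterST L M (k + 1) (fun A => Real.exp (-action1 A)) B
      = Z0 L (towerM L M k)
        * iterST L M k (fun A => Real.exp (-S1 (towerM L M k) ((sigmaL d L ^ 2) • Delta1 L (towerM L M k)) A)) B := by
  have h1 : scaleDens L (rtT L (towerM L M k) fun A : Fld (towerM L M (k + 1)) => Real.exp (-action1 A))
      = fun A => Z0 L (towerM L M k)
          * Real.exp (-S1 (towerM L M k) ((sigmaL d L ^ 2) • Delta1 L (towerM L M k)) A) :=
    funext fun A => iterST_one_gauss L (towerM L M k) A
  rw [iterST_succ, h1, iterST_const_mul]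

/-- in `W`-form: the seed of the remaining `k` steps is `σ·Wmap` of (1.14), the factor split off is `Z^{(0)} = Z0 L
(towerM L M k)`: `Witer (k+1) 𝒯 = Witer k (σ·Wmap)`, `Zfactors (k+1) 𝒯 = Zfactors k (σ·Wmap) ++ [Z0]`.
[cite: Balaban1984PropagatorsI, (1.16) p.20, (1.14) p.19] -/
theorem Witer_succ_curvLin (k : ℕ) :
    Witer L M (k + 1) (curvLin (towerM L M (k + 1))) = Witer L M k (sigmaL d L • Wmap L (towerM L M k))
      ∧ Zfactors L M (k + 1) (curvLin (towerM L M (k + 1)))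
        = Zfactors L M k (sigmaL d L • Wmap L (towerM L M k)) ++ [Z0 L (towerM L M k)] :=
  ⟨rfl, rfl⟩

/-! ## §4  Identification with r02's one-shot (1.19): `Δ_k = (Witer k 𝒯)†(Witer k 𝒯)`, `Z_{k,Ax}` a product (d ≥ 2) -/

omit [NeZero L] hM in
/-- Gaussian uniqueness, constants: two representations `c·e^{−q(B)}`, `c′·e^{−q′(B)}` of one function with `q(0) = q′(0)
= 0` have `c = c′`. [cite: Balaban1984PropagatorsI, (1.19) p.20] -/
private theorem const_eq_of_gauss_eq {c c' : ℝ} {q q' : Fld M → ℝ} (hq : q 0 = 0) (hq' : q' 0 = 0)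
    (h : ∀ B, c * Real.exp (-q B) = c' * Real.exp (-q' B)) : c = c' := by
  have h0 := h 0
  rwa [hq, hq', neg_zero, Real.exp_zero, mul_one, mul_one] at h0

omit [NeZero L] hM in
/-- Gaussian uniqueness, exponents: if moreover `c ≠ 0` then `q = q′`. [cite: Balaban1984PropagatorsI, (1.19) p.20] -/
private theorem exponent_eq_of_gauss_eq {c c' : ℝ} {q q' : Fld M → ℝ} (hq : q 0 = 0) (hq' : q' 0 = 0)
    (h : ∀ B, c * Real.exp (-q B) = c' * Real.exp (-q' B)) (hc : c ≠ 0) (B : Fld M) : q B = q' B := by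
  have hcc := const_eq_of_gauss_eq M hq hq' h
  have hB := h B
  rw [← hcc] at hB
  have := mul_left_cancel₀ hc hB
  have := Real.exp_injective this
  linarith

omit [NeZero L] in
/-- `S1` vanishes at `0`. [cite: Balaban1984PropagatorsI, (1.14) p.19] -/
private theorem S1_zero (Δ : Fld M →ₗ[ℝ] Fld M) : S1 M Δ 0 = 0 := by
  rw [S1, map_zero, inner_zero_right, mul_zero]

/-- **`Zprod k 𝒯 = z^{(k)}·Z_k`** for the numerical factor `z^{(k)}` of (1.17) (r02's `eq117_holds`) and the composite
normalisation `Zk` of (1.19) (`rt17_gauss`), d ≥ 2. [cite: Balaban1984PropagatorsI, (1.17) p.20, (1.19) p.20] -/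
theorem Zprod_curvLin_eq (hd : 2 ≤ d) (k : ℕ) :
    ∃ z : ℝ, 0 < z ∧ Zprod L M k (curvLin (towerM L M k)) = z * Zk L M k := by
  obtain ⟨z, hz, h⟩ := eq117_holds L M hd k
  refine ⟨z, hz, ?_⟩
  refine const_eq_of_gauss_eq M (q := S1 M (LinearMap.adjoint (Witer L M k (curvLin (towerM L M k)))
    ∘ₗ Witer L M k (curvLin (towerM L M k)))) (q' := S1 M (DeltaK L M k)) (S1_zero M _) (S1_zero M _) fun B => ?_
  rw [← iterST_gaussW_S1, ← exp_neg_action1_eq, h B, rt17_gauss, mul_assoc]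

/-- **`Zprod k 𝒯 > 0`** (d ≥ 2). [cite: Balaban1984PropagatorsI, (1.19) p.20] -/
theorem Zprod_curvLin_pos (hd : 2 ≤ d) (k : ℕ) : 0 < Zprod L M k (curvLin (towerM L M k)) := by
  obtain ⟨z, hz, h⟩ := Zprod_curvLin_eq L M hd k
  rw [h]
  exact mul_pos hz (Zk_pos L M hd k)

/-- **EVERY FACTOR `Z^{(j)}` IS POSITIVE** (d ≥ 2): a product of non-negative reals is positive only if each is.
[cite: Balaban1984PropagatorsI, (1.19) p.20] -/
theorem Zfactors_curvLin_pos (hd : 2 ≤ d) (k : ℕ) :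
    ∀ z ∈ Zfactors L M k (curvLin (towerM L M k)), 0 < z := by
  intro z hz
  have hprod := Zprod_curvLin_pos L M hd k
  rw [Zprod_eq_prod] at hprod
  rcases (Zfactors_nonneg L M k _ z hz).lt_or_eq with hpos | hzero
  · exact hpos
  · exfalso
    have : (Zfactors L M k (curvLin (towerM L M k))).prod = 0 := List.prod_eq_zero (hzero ▸ hz)
    rw [this] at hprod
    exact lt_irrefl 0 hprod

/-- **`½⟨B, Δ_kB⟩ = ½‖Witer k 𝒯 B‖²`**: the exponent of r02's one-shot (1.19) is the iterated one (d ≥ 2; Gaussian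
uniqueness). [cite: Balaban1984PropagatorsI, (1.19) p.20] -/
theorem S1_DeltaK_eq_half_norm_Witer_sq (hd : 2 ≤ d) (k : ℕ) (B : Fld M) :
    S1 M (DeltaK L M k) B = 1 / 2 * ‖Witer L M k (curvLin (towerM L M k)) B‖ ^ 2 := by
  obtain ⟨z, hz, h⟩ := eq117_holds L M hd k
  have key : ∀ B', Zprod L M k (curvLin (towerM L M k))
      * Real.exp (-S1 M (LinearMap.adjoint (Witer L M k (curvLin (towerM L M k)))
          ∘ₗ Witer L M k (curvLin (towerM L M k))) B')
      = (z * Zk L M k) * Real.exp (-S1 M (DeltaK L M k) B') := fun B' => by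
    rw [← iterST_gaussW_S1, ← exp_neg_action1_eq, h B', rt17_gauss, mul_assoc]
  have hq := exponent_eq_of_gauss_eq M (S1_zero M _) (S1_zero M _) key (Zprod_curvLin_pos L M hd k).ne' B
  rw [← hq, S1, LinearMap.comp_apply, LinearMap.adjoint_inner_right, real_inner_self_eq_norm_sq]

/-- **`Δ_k = (Witer k 𝒯)†(Witer k 𝒯)`**: the covariance operator of r02's one-shot (1.19) (`DeltaK = Wk†Wk`) IS the
one generated by iterating the one-step map of (1.14) `k` times (d ≥ 2) — two symmetric operators with the same
quadratic form. [cite: Balaban1984PropagatorsI, (1.19) p.20, (1.16) p.20] -/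
theorem DeltaK_eq_adjoint_Witer (hd : 2 ≤ d) (k : ℕ) :
    DeltaK L M k = LinearMap.adjoint (Witer L M k (curvLin (towerM L M k))) ∘ₗ Witer L M k (curvLin (towerM L M k)) := by
  set W := Witer L M k (curvLin (towerM L M k)) with hW
  have h1 : (DeltaK L M k).IsSymmetric := fun B B' => DeltaK_symm L M k B B'
  have h2 : (LinearMap.adjoint W ∘ₗ W).IsSymmetric := by
    intro B B'
    simp only [LinearMap.comp_apply, LinearMap.adjoint_inner_left, LinearMap.adjoint_inner_right]
  have hzero : ∀ B : Fld M, ⟪(DeltaK L M k - LinearMap.adjoint W ∘ₗ W) B, B⟫_ℝ = 0 := by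
    intro B
    have hS := S1_DeltaK_eq_half_norm_Witer_sq L M hd k B
    rw [S1, ← hW] at hS
    rw [LinearMap.sub_apply, inner_sub_left, real_inner_comm, LinearMap.comp_apply, LinearMap.adjoint_inner_left,
      real_inner_self_eq_norm_sq]
    linarith
  exact sub_eq_zero.1 ((h1.sub h2).inner_map_self_eq_zero.1 hzero)

/-- **«Z_{k,Ax} = Z^{(k−1)}·…·Z^{(0)}» FOR r02's (1.19)** (d ≥ 2): `((ST)^k e^{−S})(B) = (Z^{(k−1)}·…·Z^{(0)})·exp(−½⟨B,
Δ_kB⟩)` with `k` explicit positive one-step normalisation factors — `Zfactors k 𝒯`, each the Gaussian normalisation of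
one integration. [cite: Balaban1984PropagatorsI, (1.19) p.20] -/
theorem iterST_exp_eq_prod_DeltaK (hd : 2 ≤ d) (k : ℕ) (B : Fld M) :
    iterST L M k (fun A => Real.exp (-action1 A)) B
      = (Zfactors L M k (curvLin (towerM L M k))).prod * Real.exp (-S1 M (DeltaK L M k) B) := by
  rw [iterST_exp_eq_Zprod, Zprod_eq_prod, gaussW_eq_exp_neg_S1, ← DeltaK_eq_adjoint_Witer L M hd]

/-- **(1.19) with the product normalisation, packaged**: there is a list of `k` positive numbers `Z^{(k−1)}, …, Z^{(0)}`
(the one-step normalisations) whose product is `Z_{k,Ax}`: `((ST)^k e^{−S})(B) = (Π_j Z^{(j)})·exp(−½⟨B, Δ_kB⟩)` for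
every `B`, `Δ_k = B5Eq114Gauss.DeltaK` (d ≥ 2). [cite: Balaban1984PropagatorsI, (1.19) p.20] -/
theorem eq119_prod (hd : 2 ≤ d) (k : ℕ) :
    ∃ Zs : List ℝ, Zs.length = k ∧ (∀ z ∈ Zs, 0 < z) ∧ ∀ B : Fld M,
      iterST L M k (fun A => Real.exp (-action1 A)) B = Zs.prod * Real.exp (-S1 M (DeltaK L M k) B) :=
  ⟨Zfactors L M k (curvLin (towerM L M k)), length_Zfactors L M k _, Zfactors_curvLin_pos L M hd k,
    iterST_exp_eq_prod_DeltaK L M hd k⟩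

end Tower

end

end Literature.MathematicalPhysics.QuantumFieldTheory.Balaban1983to89.B5Eq119ZProduct
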